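import Literature.IUT.HodgeTheaters.InitialThetaDataArith
import Literature.IUT.HodgeTheaters.ThetaDataField
import Literature.NumberTheory.EllipticCurves.VariableChangePointsMap
import HarnessLib

/-!
# [IUTchIV] Cor. 2.2 (ii), step (P7) / [IUTchI] Def. 3.1: initial Θ-data on `E_F := W ⊗ F`,
# `F := F_mod(√−1, W[2·3·5])`, for a MODEL `W` over `F_mod` — the arithmetic clauses DISCHARGED

Mochizuki, *Inter-universal Teichmüller theory IV*, RIMS manuscript (Apr. 2020; = PRIMS **57** (2021)),
Cor. 2.2 (ii), proof p. 46: "it follows formally from (P1), (P2), (P5), and (P6) that, if one takes … '`F`' to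
be the number field `F` …, '`X_F`' to be the once-punctured elliptic curve associated to `E_F`, '`l`' to be the
prime number `l` …, and '`𝕍^bad_mod`' to be the set `𝕍^bad_mod` of (P5), then there exist data '`C̲_K`', '`𝕍̲`',
and '`ε̲`' such that all of the conditions of [IUTchI], Definition 3.1, (a), (b), (c), (d), (e), (f), are
satisfied"; Thm. 1.10, p. 22: "`F = F_mod(√−1, E_{F_mod}[2·3·5])`"; [IUTchI] Def. 3.1 (a)(b), pp. 61–62.

THIS FILE is the route's layer-2 child (i) «ThetaDataExists» / definition item D1 of
`Summit.ABC.ABC.Theses.IUTThetaPilot` (crux `ThetaPartII`) in the SHAPE RULED by the route owner on FLAG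
CANDIDATE F4 (abc-iut-plan 2026-08-25T23:31:36Z; finding F-L5t7-1): the datum is built on
`E_F := W ⊗_{F_mod} F` for a MODEL `W` over `F_mod = ℚ(j)` (hypothesis `hgen : ℚ⟮j(W)⟯ = F_mod`; models over the
field of moduli exist, Prop. 1.8 (ii) / Mathlib `WeierstrassCurve.ofJ`) and `F := F_mod(√−1, W[2·3·5])`
(`ThetaDataField.lean`) — NOT on the Legendre curve over the theta field `F_tpd(√−1, E^Leg[3·5])`, which in
general is not Galois over `F_mod` (so `InitialThetaData.isGalois_fieldOfModuli` would be false there).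
DISCHARGED here, for `E_F = modelCurve W`, `F = ThetaF W`, `F̄ = AlgebraicClosure F`:
* (b) **the `2·3·5`-torsion of `E_F(F̄)` is `F`-rational** (`torsion_thirty_rational`: over `K̄₀` by
  `coord_mem_thetaDataField` through the identity-on-coordinates transport `(W ⊗ F) ⊗ K̄₀ = W ⊗ K̄₀`
  (`Affine.Point.congrEquiv`), then moved to `AlgebraicClosure F` along `IsAlgClosure.equiv`
  (`torsion_rational_transfer`)) — hence stable reduction everywhere and rational `2·3`-torsion
  (`InitialThetaData.ofArith`);
* (a) `√−1 ∈ F`; (b) **`IsGalois (fieldOfModuli E_F) F`** in the EXACT shape of the structure field — the field of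
  moduli `ℚ(j(E_F)) ⊆ F` receives `F_mod` (`modelHomFieldOfModuli`, needs `hgen`), and `F/F_mod` is Galois
  (`isGalois_thetaDataField`) — and **`[F : ℚ(j(E_F))] ∣ [F : F_mod] ∣ 2·6·48·480`, prime to `l ≥ 7`**.
HYPOTHESES kept (`BadPlaceInput`): the places `V^bad_mod` with their printed side conditions ((P2)/(P5):
nonempty, odd, bad multiplicative reduction over them, `l` prime to them and to the local heights) and (P6)
`SL₂(𝔽_l) ⊆ Im(G_F)` on `E_F[l]` — to be produced OVER `F` from (P2),(P4),(P5) by the campaign-S dictionary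
(abc-iut-S-d4: re-run, not transported up from the theta field) — plus the geometry INTERFACE of Def. 3.1
(d)(e)(f). RESULT: `exists_initialThetaData_ofModel`. Classical; nothing here takes a side on [IUTchIII]
Cor. 3.12, and no printed statement is asserted.
-/

noncomputable section

open scoped Classical
open Field IntermediateField
open Literature.NumberTheory.EllipticCurves

universe u

namespace Literature.IUT.HodgeTheaters

variable {K₀ : Type u} [Field K₀] [NumberField K₀] (W : WeierstrassCurve K₀) [W.IsElliptic]

/-- `F := F_mod(√−1, W[2·3·5])` as a TYPE (a number field). [claim: Mochizuki2012, status: disputed] -/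
abbrev ThetaF : Type u := ↥(thetaDataField W)

/-- `E_F := W ⊗_{F_mod} F`. [claim: Mochizuki2012, status: disputed] -/
abbrev modelCurve : WeierstrassCurve (ThetaF W) := W.baseChange (ThetaF W)

/-- `E_F` is an elliptic curve. [claim: Mochizuki2012, status: disputed] -/
instance modelCurve_isElliptic : (modelCurve W).IsElliptic := by
  unfold modelCurve; infer_instance

/-! ## (b) the `30`-torsion of `E_F` is `F`-rational -/

omit [NumberField K₀] [W.IsElliptic] in
/-- `(W ⊗ F) ⊗ K̄₀ = W ⊗ K̄₀` (base change in the tower `F_mod ⊆ F ⊆ K̄₀`).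
[claim: Mochizuki2012, status: disputed] -/
theorem modelCurve_baseChange_closure :
    (modelCurve W).baseChange (AlgebraicClosure K₀) = W.baseChange (AlgebraicClosure K₀) :=
  W.map_baseChange (IsScalarTower.toAlgHom K₀ (ThetaF W) (AlgebraicClosure K₀))

/-- Every `K̄₀`-point of `E_F` killed by `30` is `F`-rational. [claim: Mochizuki2012, status: disputed] -/
theorem torsion_thirty_rational_closure
    (Q : ((modelCurve W).toAffine.baseChange (AlgebraicClosure K₀)).Point) (hQ : (30 : ℤ) • Q = 0) :
    Q ∈ Set.range (WeierstrassCurve.Affine.Point.baseChange (W' := (modelCurve W).toAffine)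
      (ThetaF W) (AlgebraicClosure K₀)) := by
  -- transport `Q` to a point `Q'` of `W ⊗ K̄₀` (identity on coordinates)
  set Q' := WeierstrassCurve.Affine.Point.congrEquiv (modelCurve_baseChange_closure W) Q with hQ'def
  have hQ' : (30 : ℤ) • Q' = 0 := by
    have h := (map_zsmul (WeierstrassCurve.Affine.Point.congrEquiv (modelCurve_baseChange_closure W))
      (30 : ℤ) Q).symm
    rw [hQ, map_zero] at h
    exact h
  -- as an element of the tree's `W.geomPoints` (same type up to the synonym, same scalar action)
  have hQ'' : (30 : ℤ) • (show W.geomPoints from Q') = 0 := hQ'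
  rcases Q with _ | ⟨x, y, hxy⟩
  · exact ⟨0, by rw [map_zero]; rfl⟩
  · have hsome : (show W.geomPoints from Q') = WeierstrassCurve.Affine.Point.some x y
        (modelCurve_baseChange_closure W ▸ hxy) := by
      show Q' = _
      rw [hQ'def, WeierstrassCurve.Affine.Point.congrEquiv_some]
    obtain ⟨hx, hy⟩ := coord_mem_thetaDataField W hQ'' hsome
    -- the `F`-point with these coordinates
    have hinj : Function.Injective (algebraMap (ThetaF W) (AlgebraicClosure K₀)) :=
      (algebraMap (ThetaF W) (AlgebraicClosure K₀)).injective
    have hns : (modelCurve W).toAffine.Nonsingular (⟨x, hx⟩ : ThetaF W) ⟨y, hy⟩ :=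
      (WeierstrassCurve.Affine.map_nonsingular (W := (modelCurve W).toAffine) hinj
        (⟨x, hx⟩ : ThetaF W) ⟨y, hy⟩).mp hxy
    refine ⟨WeierstrassCurve.Affine.Point.some _ _ hns, ?_⟩
    rw [WeierstrassCurve.Affine.Point.baseChange, WeierstrassCurve.Affine.Point.map_some]
    rfl

/-- **Transfer of "all `n`-torsion points are `F`-rational" between two algebraic closures of `F`** (along
an `F`-isomorphism `Ω₁ ≃ₐ[F] Ω₂`: `Point.map`, `Point.map_baseChange`; plumbing for Def. 3.1 (b)).
[claim: Mochizuki2012, status: disputed] -/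
theorem torsion_rational_transfer {F : Type u} [Field F] (E : WeierstrassCurve F) {Ω₁ Ω₂ : Type u}
    [Field Ω₁] [Field Ω₂] [Algebra F Ω₁] [Algebra F Ω₂] (e : Ω₁ ≃ₐ[F] Ω₂) (n : ℤ)
    (h : ∀ P : (E.toAffine.baseChange Ω₁).Point, n • P = 0 →
      P ∈ Set.range (WeierstrassCurve.Affine.Point.baseChange (W' := E.toAffine) F Ω₁))
    (Q : (E.toAffine.baseChange Ω₂).Point) (hQ : n • Q = 0) :
    Q ∈ Set.range (WeierstrassCurve.Affine.Point.baseChange (W' := E.toAffine) F Ω₂) := by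
  set P := WeierstrassCurve.Affine.Point.map (W' := E.toAffine) (e.symm : Ω₂ →ₐ[F] Ω₁) Q with hP
  have hPn : n • P = 0 := by rw [hP, ← map_zsmul, hQ, map_zero]
  obtain ⟨R, hR⟩ := h P hPn
  refine ⟨R, ?_⟩
  have hback : WeierstrassCurve.Affine.Point.map (W' := E.toAffine) (e : Ω₁ →ₐ[F] Ω₂) P = Q := by
    rw [hP]
    rcases Q with _ | ⟨x, y, hxy⟩
    · rfl
    · rw [WeierstrassCurve.Affine.Point.map_some, WeierstrassCurve.Affine.Point.map_some]
      congr 1 <;> exact e.apply_symm_apply _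
  rw [← hback, ← hR, WeierstrassCurve.Affine.Point.map_baseChange]

/-- `K̄₀` is an algebraic closure of `F` (`F ⊆ K̄₀` algebraic). [claim: Mochizuki2012, status: disputed] -/
instance isAlgClosure_thetaF : IsAlgClosure (ThetaF W) (AlgebraicClosure K₀) where
  isAlgClosed := inferInstance
  isAlgebraic := Algebra.IsAlgebraic.tower_top (K := K₀) (ThetaF W)

/-- **(b) Every `F̄`-point of `E_F` killed by `30` is `F`-rational** ("the `(3·5)`-torsion [indeed the
`2·3·5`-torsion] points of `E_F` are defined over `F`", [IUTchIV] Thm. 1.10 p. 22; `F̄ = AlgebraicClosure F`).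
[claim: Mochizuki2012, status: disputed] -/
theorem torsion_thirty_rational (Q : GeomPoints (AlgebraicClosure (ThetaF W)) (modelCurve W))
    (hQ : (30 : ℤ) • Q = 0) :
    Q ∈ Set.range (WeierstrassCurve.Affine.Point.baseChange (W' := (modelCurve W).toAffine)
      (ThetaF W) (AlgebraicClosure (ThetaF W))) :=
  torsion_rational_transfer (modelCurve W)
    (IsAlgClosure.equiv (ThetaF W) (AlgebraicClosure K₀) (AlgebraicClosure (ThetaF W))) 30
    (torsion_thirty_rational_closure W) Q hQ

/-! ## (b) `F_mod = ℚ(j)` inside `F`: Galois and degree -/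

/-- `ℚ → F_mod → F` is a scalar tower (any ring maps between characteristic-zero fields are `ℚ`-linear).
[claim: Mochizuki2012, status: disputed] -/
instance isScalarTower_rat_thetaF : IsScalarTower ℚ K₀ (ThetaF W) :=
  IsScalarTower.of_algebraMap_eq fun q => by simp [map_ratCast]

/-- The structure map `F_mod → F` as a `ℚ`-algebra homomorphism. [claim: Mochizuki2012, status: disputed] -/
def modelHom : K₀ →ₐ[ℚ] ThetaF W := (Algebra.ofId K₀ (ThetaF W)).restrictScalars ℚ

omit [NumberField K₀] in
/-- `j(E_F) = j(W)` (base change does not change `j`). [claim: Mochizuki2012, status: disputed] -/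
theorem modelCurve_j : (modelCurve W).j = algebraMap K₀ (ThetaF W) W.j := by
  unfold modelCurve WeierstrassCurve.baseChange
  rw [WeierstrassCurve.map_j]

/-- If `F_mod = ℚ(j(W))` then `F_mod ⊆ F` lands in the field of moduli `ℚ(j(E_F)) ⊆ F` of `E_F`.
[claim: Mochizuki2012, status: disputed] -/
theorem modelHom_mem_fieldOfModuli (hgen : IntermediateField.adjoin ℚ {W.j} = ⊤) (x : K₀) :
    algebraMap K₀ (ThetaF W) x ∈ fieldOfModuli (modelCurve W) := by
  have hx : x ∈ (⊤ : IntermediateField ℚ K₀) := IntermediateField.mem_top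
  rw [← hgen] at hx
  have hmap : (IntermediateField.adjoin ℚ {W.j}).map (modelHom W) =
      IntermediateField.adjoin ℚ {(modelCurve W).j} := by
    rw [IntermediateField.adjoin_map, Set.image_singleton, modelCurve_j]
    rfl
  have : modelHom W x ∈ (IntermediateField.adjoin ℚ {W.j}).map (modelHom W) := ⟨x, hx, rfl⟩
  rw [hmap] at this
  exact this

/-- The structure map `F_mod → ℚ(j(E_F))` (corestriction), for `F_mod = ℚ(j(W))`.
[claim: Mochizuki2012, status: disputed] -/
def modelHomFieldOfModuli (hgen : IntermediateField.adjoin ℚ {W.j} = ⊤) :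
    K₀ →+* fieldOfModuli (modelCurve W) :=
  (algebraMap K₀ (ThetaF W)).codRestrict (fieldOfModuli (modelCurve W)).toSubring
    (modelHom_mem_fieldOfModuli W hgen)

/-- **(b) `F/F_mod` is Galois**, in the EXACT shape of `InitialThetaData.isGalois_fieldOfModuli` (`F_mod` =
the field of moduli `ℚ(j(E_F)) ⊆ F`): from `IsGalois F_mod F` (`isGalois_thetaDataField`) along the tower
`F_mod → ℚ(j(E_F)) ⊆ F`. [claim: Mochizuki2012, status: disputed] -/
theorem isGalois_fieldOfModuli_modelCurve (hgen : IntermediateField.adjoin ℚ {W.j} = ⊤) :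
    IsGalois (fieldOfModuli (modelCurve W)) (ThetaF W) := by
  letI : Algebra K₀ (fieldOfModuli (modelCurve W)) := (modelHomFieldOfModuli W hgen).toAlgebra
  haveI : IsScalarTower K₀ (fieldOfModuli (modelCurve W)) (ThetaF W) :=
    IsScalarTower.of_algebraMap_eq fun _ => rfl
  exact IsGalois.tower_top_of_isGalois K₀ (fieldOfModuli (modelCurve W)) (ThetaF W)

/-- **(b) `[F : ℚ(j(E_F))] ∣ [F : F_mod] ∣ 2·6·48·480`**, hence prime to every prime `l ≥ 7`.
[claim: Mochizuki2012, status: disputed] -/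
theorem finrank_fieldOfModuli_coprime (hgen : IntermediateField.adjoin ℚ {W.j} = ⊤) {l : ℕ}
    (hl : l.Prime) (h7 : 7 ≤ l) :
    (Module.finrank (fieldOfModuli (modelCurve W)) (ThetaF W)).Coprime l := by
  letI : Algebra K₀ (fieldOfModuli (modelCurve W)) := (modelHomFieldOfModuli W hgen).toAlgebra
  haveI : IsScalarTower K₀ (fieldOfModuli (modelCurve W)) (ThetaF W) :=
    IsScalarTower.of_algebraMap_eq fun _ => rfl
  have hdvd : Module.finrank (fieldOfModuli (modelCurve W)) (ThetaF W) ∣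
      Module.finrank K₀ (ThetaF W) :=
    Dvd.intro_left _ (Module.finrank_mul_finrank K₀ (fieldOfModuli (modelCurve W)) (ThetaF W))
  exact Nat.Coprime.coprime_dvd_left hdvd (finrank_thetaDataField_coprime W hl h7)

/-! ## Assembly: the arithmetic input for `E_F = W ⊗ F`, and the existence of initial Θ-data -/

/-- The (P2)/(P5)/(P6)-type HYPOTHESES at the level of `F` and `F_mod`, i.e. what the proof of [IUTchIV]
Cor. 2.2 (ii) supplies for the chosen prime `l` and bad places (pp. 45–46): `V^bad_mod` (nonempty, odd, bad
multiplicative reduction of `E_F` over it), `l ≥ 7` prime, `l` prime to the residue characteristics of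
`V^bad_mod` and to the local heights over it, and `SL₂(𝔽_l) ⊆ Im(G_F)` on `E_F[l]` (to be re-derived over `F`
from (P2), (P4), (P5), abc-iut-S-d4 2026-08-25T23:23:59Z — NOT transported up from the theta field).
[claim: Mochizuki2012, status: disputed] -/
structure BadPlaceInput (l : ℕ) where
  /-- `V^bad_mod` -/
  VbadMod : Set (NumberField.FinitePlace (fieldOfModuli (modelCurve W)))
  /-- `V^bad_mod ≠ ∅` ((P5)) -/
  VbadMod_nonempty : VbadMod.Nonempty
  /-- odd residue characteristics ((P5): the bad places do not divide `2l`) -/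
  VbadMod_odd : ∀ w ∈ VbadMod, Odd (residueChar w)
  /-- bad multiplicative reduction of `E_F` over `V^bad_mod` -/
  multiplicative_over_VbadMod : ∀ v : NumberField.FinitePlace (ThetaF W),
    Val.restrict (fieldOfModuli (modelCurve W)) (Val.non v) ∈ Val.non '' VbadMod →
      (modelCurve W).HasMultiplicativeReductionAt v.maximalIdeal
  /-- `l` prime -/
  l_prime : l.Prime
  /-- `l ≥ 7` ((P1): `l > h^{1/2} ≥ 5`; and `l ∤ 2·3·5`) -/
  seven_le_l : 7 ≤ l
  /-- `SL₂(𝔽_l) ⊆ Im(G_F → GL₂(𝔽_l))` on `E_F[l]` ((P6), over `F`) -/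
  imageContainsSL2 : ImageContainsSL2 (AlgebraicClosure (ThetaF W)) (modelCurve W) l
  /-- `l ∤` residue characteristics of `V^bad_mod` ((P5)) -/
  l_ne_residueChar : ∀ w ∈ VbadMod, residueChar w ≠ l
  /-- `l` prime to the local heights over `V^bad_mod` ((P2)) -/
  l_coprime_qParamOrd : ∀ v : NumberField.FinitePlace (ThetaF W),
    Val.restrict (fieldOfModuli (modelCurve W)) (Val.non v) ∈ Val.non '' VbadMod →
      l.Coprime (qParamOrd (modelCurve W) v.maximalIdeal)

/-- **The arithmetic input of Def. 3.1 for `E_F := W ⊗ F`, `F := F_mod(√−1, W[2·3·5])`** (`F_mod = ℚ(j(W))`):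
(a) and the non-place clauses of (b) are DISCHARGED (`√−1 ∈ F`, `30`-torsion rational, `F/F_mod` Galois of
degree prime to `l`, `l ≥ 5`); the place clauses and (P6) come from `BadPlaceInput`.
[claim: Mochizuki2012, status: disputed] -/
def arithInputOfModel (hgen : IntermediateField.adjoin ℚ {W.j} = ⊤) {l : ℕ} (B : BadPlaceInput W l) :
    ArithInput (modelCurve W) l where
  sqrt_neg_one_mem := exists_sq_eq_neg_one W
  torsion_thirty_rational := torsion_thirty_rational W
  VbadMod := B.VbadMod
  VbadMod_nonempty := B.VbadMod_nonempty
  VbadMod_odd := B.VbadMod_odd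
  multiplicative_over_VbadMod := B.multiplicative_over_VbadMod
  isGalois_fieldOfModuli := isGalois_fieldOfModuli_modelCurve W hgen
  finrank_coprime := finrank_fieldOfModuli_coprime W hgen B.l_prime B.seven_le_l
  l_prime := B.l_prime
  five_le_l := le_trans (by norm_num) B.seven_le_l
  imageContainsSL2 := B.imageContainsSL2
  l_ne_residueChar := B.l_ne_residueChar
  l_coprime_qParamOrd := B.l_coprime_qParamOrd

/-- **[IUTchIV] Cor. 2.2 (ii), (P7), arithmetic half — EXISTENCE of initial Θ-data on `E_F = W ⊗ F`** for a
model `W` over `F_mod = ℚ(j(W))`, the chosen `l` and bad places, modulo exactly the `π₁`-geometry INTERFACE of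
Def. 3.1 (d)(f) and the bad-place predicates of (e)(f) (FACT-policy boundary). The route's layer-2 child (i)
«ThetaDataExists» then needs: an `F_mod`-model of `E_λ` (Prop. 1.8 (ii); `WeierstrassCurve.ofJ`), the
`BadPlaceInput` from (P2)/(P5)/(P6) at the λ-line point (campaign S dictionary), and this theorem.
[claim: Mochizuki2012, status: disputed] -/
theorem exists_initialThetaData_ofModel (hgen : IntermediateField.adjoin ℚ {W.j} = ⊤) {l : ℕ}
    [NeZero l] (B : BadPlaceInput W l)
    (Pb : BadPlacePredicates (TorsionField (modelCurve W) l))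
    (geom : ThetaGeometry.{u} (AlgebraicClosure (ThetaF W) ≃ₐ[ThetaF W] AlgebraicClosure (ThetaF W))
      (galoisSubgroupOf (ThetaF W) (TorsionField (modelCurve W) l) (AlgebraicClosure (ThetaF W))) l)
    (hbad_type : ∀ w : Val (TorsionField (modelCurve W) l),
      toVMod (ThetaF W) (TorsionField (modelCurve W) l) (modelCurve W) w ∈ Val.non '' B.VbadMod →
        Pb.IsTypeOneZModLPM w)
    (hbad_cusp : ∀ w : Val (TorsionField (modelCurve W) l),
      toVMod (ThetaF W) (TorsionField (modelCurve W) l) (modelCurve W) w ∈ Val.non '' B.VbadMod →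
        Pb.IsCanonicalGeneratorCusp w) :
    ∃ D : InitialThetaData (ThetaF W) (TorsionField (modelCurve W) l) (AlgebraicClosure (ThetaF W))
        (modelCurve W) l Pb, D.VbadMod = B.VbadMod := by
  exact InitialThetaData.exists_ofArith (modelCurve W) l (arithInputOfModel W hgen B) Pb geom
    hbad_type hbad_cusp


end Literature.IUT.HodgeTheaters

end
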